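import Literature.NumberTheory.GelbartRogawski1991.UnitaryDualPairWeilCoinvariants
import Literature.NumberTheory.Weil1964.AdelicMetaplecticFinRepBlockDiag
import HarnessLib

/-!
# Conjugate Kronecker Weil operators with a decomposable conjugator give conjugate finite Weil representations

Setting (★ `UnitaryDualPairWeilCoinvariants`): a quadratic extension `E/F`, two V-forms `J_V`, `J_V′` of the same rank over ONE W-form
`J_W`, two compatible pair splittings `s` (at `J_V`) and `s′` (at `J_V′`) ([GelbartRogawski1991, Prop. 3.1.1]), and their finite Weil
representations `ω_f(s)`, `ω′_f(s′)` on `𝒮((𝔸_{F,f})^{N·M})` (`finPairRep`).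

* `finPairRep_eq_conj_of_omega_conj` — if the Kronecker-coordinate Weil operators of `s′` are conjugate to those of `s ∘ θ` by an element
  `r ∈ Mp_ψ(𝕎_𝔸)ᶜᵒⁿᵗ` whose Weil operator is DECOMPOSABLE on pure tensors, `ω(r)(Φ ⊗ f) = A Φ ⊗ Q_f f` ([Weil1964, n° 38–40]: the operator of a
  rational element is a restricted tensor product), for a homomorphism `θ : U(J_V′ ⊗ J_W)(𝔸) →* U(J_V ⊗ J_W)(𝔸)` carrying the finite-adelic
  pair points `(k′, u)` to `(φ k′, u)`, then the finite Weil representations are conjugate by the finite leg: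
  `ω′_f(s′)(k′, u) = Q_f⁻¹ ∘ ω_f(s)(φ k′, u) ∘ Q_f` ([MoeglinVignerasWaldspurger1987, Chap. 2 II.1]: transport of structure along an
  isometry).  Proof: evaluate the operator identity at `A⁻¹Φ₀ ⊗ g` with `Φ₀(0) = 1`, read the three operators on pure tensors
  (★ `omega_pairSmall₁_apply`, ★ `omega_pairSmall₁_finPairToAdelic_tmul`, ★ `pairRep_finPairToAdelic_piSBReindex_tmul`) and strip the
  archimedean factor with the finite slice at the origin (★ `finSliceLM_tmul`).

One theorem; no definition, no named fact, no `sorry`.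

## References
* [Weil1964] A. Weil, Acta Math. 111 (1964), Chap. III n° 38–40 pp. 188–191.
* [MoeglinVignerasWaldspurger1987] C. Mœglin, M.-F. Vignéras, J.-L. Waldspurger, LNM 1291 (1987), Chap. 2 II.1.
* [GelbartRogawski1991] S. Gelbart, J. Rogawski, Invent. Math. 105 (1991), §3.1 Prop. 3.1.1 p. 455.
-/

set_option autoImplicit false

noncomputable section

open scoped Matrix Kronecker TensorProduct SchwartzMap Classical
open NumberField NumberField.mixedEmbedding IsDedekindDomain
open Literature.NumberTheory.Automorphic Literature.NumberTheory.Automorphic.UnitaryGroup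
open Literature.NumberTheory.Weil1964 Literature.RepresentationTheory.HeisenbergGroup

namespace Literature.NumberTheory.GelbartRogawski1991.UnitaryDualPair.WeilCoinv

section Head

variable (F E : Type) [Field F] [NumberField F] [Field E] [NumberField E] [Algebra F E]
variable (c : E ≃ₐ[F] E) (N M : ℕ) {n : ℕ} (e : Fin N × Fin M ≃ Fin n)
variable (JV JV' : Matrix (Fin N) (Fin N) E) (JW : Matrix (Fin M) (Fin M) E)
variable {TV TV' : Matrix (Fin N) (Fin N) F} {TW : Matrix (Fin M) (Fin M) F}
variable [Algebra.IsQuadraticExtension F E] {δ : E} (hcδ : c δ = -δ) (hδ : δ ≠ 0) {d : F}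
  (hd : δ * δ = algebraMap F E d) (hV : TV.IsSymm) (hV' : TV'.IsSymm) (hW : TW.IsSymm) (hVd : IsUnit TV.det)
  (hVd' : IsUnit TV'.det) (hWd : IsUnit TW.det) (hJV : JV = TV.map (algebraMap F E))
  (hJV' : JV' = TV'.map (algebraMap F E)) (hJW : JW = TW.map (algebraMap F E))
  {s : adelicPair F E c N M JV JW →* adelicMpCont F (Fin n) (adelicGram F e TV TW)}
  {s' : adelicPair F E c N M JV' JW →* adelicMpCont F (Fin n) (adelicGram F e TV' TW)}
  (hs : (splittingDatum F E c N M e JV JW hcδ hδ hd hV hW hVd hWd hJV hJW).IsCompatible s)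
  (hs' : (splittingDatum F E c N M e JV' JW hcδ hδ hd hV' hW hVd' hWd hJV' hJW).IsCompatible s')

/-- **THE (T) JOIN LEMMA — conjugate Kronecker operators with a decomposable conjugator give conjugate finite Weil
representations.**  Data: a conjugator `r ∈ Mp_ψ(𝕎_{T_V ⊗ T_W})ᶜᵒⁿᵗ` with `ω(r)(Φ ⊗ f) = A Φ ⊗ Q_f f` (`hq`); a homomorphism `θ : U(J_V′ ⊗ J_W)(𝔸) →* U(J_V ⊗ J_W)(𝔸)` over a map `φ` of the finite-adelic `V`-points and the
identity on the `W`-points (`hθinl`, `hθinr`); and the operator identity `ω(r) ∘ ω′(s′ p′) = ω(s (θ p′)) ∘ ω(r)` in Kronecker coordinates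
(`hω`).  Then `ω′_f(s′)(k′, u) = Q_f⁻¹.conj (ω_f(s)(φ k′, u))`.
[cite: Weil1964, Chap. III n° 38–40 pp. 188–191] [cite: MoeglinVignerasWaldspurger1987, Chap. 2 II.1]
[cite: GelbartRogawski1991, §3.1 Prop. 3.1.1 p. 455] -/
theorem finPairRep_eq_conj_of_omega_conj
    (r : adelicMpCont F (Fin N × Fin M)
      (TV.map (algebraMap F (AdeleRing (𝓞 F) F)) ⊗ₖ TW.map (algebraMap F (AdeleRing (𝓞 F) F))))
    (A : 𝓢(((Fin N × Fin M) → mixedSpace F), ℂ) ≃L[ℂ] 𝓢(((Fin N × Fin M) → mixedSpace F), ℂ))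
    (Qf : FinSB F (Fin N × Fin M) ≃ₗ[ℂ] FinSB F (Fin N × Fin M))
    (hq : ∀ (Φinf : 𝓢(((Fin N × Fin M) → mixedSpace F), ℂ)) (f : FinSB F (Fin N × Fin M)),
      adelicMpCont.omega F (Fin N × Fin M) _ r (piSchwartzBruhatEquiv F (Fin N × Fin M) (Φinf ⊗ₜ f)) =
        piSchwartzBruhatEquiv F (Fin N × Fin M) (A Φinf ⊗ₜ Qf f))
    (θ : adelicPair F E c N M JV' JW →* adelicPair F E c N M JV JW) (φ : finAdelic F E c N JV' → finAdelic F E c N JV)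
    (hθinl : ∀ k' : finAdelic F E c N JV',
      θ (adelicInl F E c N M JV' JW (finAdelicToAdelic F E c N JV' k')) = adelicInl F E c N M JV JW (finAdelicToAdelic F E c N JV (φ k')))
    (hθinr : ∀ u : finAdelic F E c M JW,
      θ (adelicInr F E c N M JV' JW (finAdelicToAdelic F E c M JW u)) = adelicInr F E c N M JV JW (finAdelicToAdelic F E c M JW u))
    (hω : ∀ (p' : adelicPair F E c N M JV' JW) (Ψ : piSchwartzBruhat F (Fin N × Fin M)),
      adelicMpCont.omega F (Fin N × Fin M) _ r
          ((piSBReindex F e).symm (adelicMpCont.omega F (Fin n) (adelicGram F e TV' TW) (s' p') (piSBReindex F e Ψ))) =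
        (piSBReindex F e).symm
          (adelicMpCont.omega F (Fin n) (adelicGram F e TV TW) (s (θ p')) (piSBReindex F e (adelicMpCont.omega F (Fin N × Fin M) _ r Ψ))))
    (k' : finAdelic F E c N JV') (u : finAdelic F E c M JW) :
    finPairRep F E c N M e JV' JW hcδ hδ hd hV' hW hVd' hWd hJV' hJW hs' (k', u) =
      Qf.symm.conj (finPairRep F E c N M e JV JW hcδ hδ hd hV hW hVd hWd hJV hJW hs (φ k', u)) := by
  -- an archimedean test function with `φ₀(0) = 1`
  obtain ⟨φ₀, hφ₀⟩ := exists_schwartzMap_apply_zero_eq_one (F := F) (Fin N × Fin M)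
  -- the pair point and its image under `θ`
  have hθp : θ (adelicInl F E c N M JV' JW (finAdelicToAdelic F E c N JV' k') *
        adelicInr F E c N M JV' JW (finAdelicToAdelic F E c M JW u)) =
      adelicInl F E c N M JV JW (finAdelicToAdelic F E c N JV (φ k')) *
        adelicInr F E c N M JV JW (finAdelicToAdelic F E c M JW u) := by
    rw [map_mul, hθinl, hθinr]
  refine LinearMap.ext fun g => ?_
  -- `hω` at the pair point and `Ψ₀ := A⁻¹ φ₀ ⊗ g`
  have key := hω (adelicInl F E c N M JV' JW (finAdelicToAdelic F E c N JV' k') *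
      adelicInr F E c N M JV' JW (finAdelicToAdelic F E c M JW u))
    (piSchwartzBruhatEquiv F (Fin N × Fin M) (A.symm φ₀ ⊗ₜ g))
  -- LEFT: `ω(r) (ω′_Kron(s′_pair(ι k′, ι u)) Ψ₀) = φ₀ ⊗ Q_f (ω′_f(k′, u) g)`
  have e1 : (piSBReindex F e).symm (adelicMpCont.omega F (Fin n) (adelicGram F e TV' TW)
        (s' (adelicInl F E c N M JV' JW (finAdelicToAdelic F E c N JV' k') *
          adelicInr F E c N M JV' JW (finAdelicToAdelic F E c M JW u)))
        (piSBReindex F e (piSchwartzBruhatEquiv F (Fin N × Fin M) (A.symm φ₀ ⊗ₜ g)))) =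
      piSchwartzBruhatEquiv F (Fin N × Fin M)
        (A.symm φ₀ ⊗ₜ finPairRep F E c N M e JV' JW hcδ hδ hd hV' hW hVd' hWd hJV' hJW hs' (k', u) g) :=
    (omega_pairSmall₁_apply F E c N M e JV' JW s' (finPairToAdelic F E c N M JV' JW (k', u)) _).symm.trans
      (omega_pairSmall₁_finPairToAdelic_tmul F E c N M e JV' JW hcδ hδ hd hV' hW hVd' hWd hJV' hJW hs' (k', u) (A.symm φ₀) g)
  have eL : adelicMpCont.omega F (Fin N × Fin M) _ r
        ((piSBReindex F e).symm (adelicMpCont.omega F (Fin n) (adelicGram F e TV' TW)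
          (s' (adelicInl F E c N M JV' JW (finAdelicToAdelic F E c N JV' k') *
            adelicInr F E c N M JV' JW (finAdelicToAdelic F E c M JW u)))
          (piSBReindex F e (piSchwartzBruhatEquiv F (Fin N × Fin M) (A.symm φ₀ ⊗ₜ g))))) =
      piSchwartzBruhatEquiv F (Fin N × Fin M)
        (φ₀ ⊗ₜ Qf (finPairRep F E c N M e JV' JW hcδ hδ hd hV' hW hVd' hWd hJV' hJW hs' (k', u) g)) :=
    ((congrArg (adelicMpCont.omega F (Fin N × Fin M) _ r) e1).trans (hq _ _)).trans
      (congrArg (fun ψ => piSchwartzBruhatEquiv F (Fin N × Fin M)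
        (ψ ⊗ₜ Qf (finPairRep F E c N M e JV' JW hcδ hδ hd hV' hW hVd' hWd hJV' hJW hs' (k', u) g)))
        (A.apply_symm_apply φ₀))
  -- RIGHT: `R⁻¹ (ω(s_pair(ι (φ k′), ι u)) (R (ω(r) Ψ₀))) = φ₀ ⊗ ω_f(φ k′, u) (Q_f g)`
  have e4 : adelicMpCont.omega F (Fin N × Fin M) _ r (piSchwartzBruhatEquiv F (Fin N × Fin M) (A.symm φ₀ ⊗ₜ g)) =
      piSchwartzBruhatEquiv F (Fin N × Fin M) (φ₀ ⊗ₜ Qf g) :=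
    (hq _ _).trans (congrArg (fun ψ => piSchwartzBruhatEquiv F (Fin N × Fin M) (ψ ⊗ₜ Qf g)) (A.apply_symm_apply φ₀))
  have eR : (piSBReindex F e).symm (adelicMpCont.omega F (Fin n) (adelicGram F e TV TW)
        (s (θ (adelicInl F E c N M JV' JW (finAdelicToAdelic F E c N JV' k') *
          adelicInr F E c N M JV' JW (finAdelicToAdelic F E c M JW u))))
        (piSBReindex F e (adelicMpCont.omega F (Fin N × Fin M) _ r
          (piSchwartzBruhatEquiv F (Fin N × Fin M) (A.symm φ₀ ⊗ₜ g))))) =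
      piSchwartzBruhatEquiv F (Fin N × Fin M)
        (φ₀ ⊗ₜ finPairRep F E c N M e JV JW hcδ hδ hd hV hW hVd hWd hJV hJW hs (φ k', u) (Qf g)) :=
    (congrArg₂ (fun x y => (piSBReindex F e).symm (adelicMpCont.omega F (Fin n) (adelicGram F e TV TW) (s x)
        (piSBReindex F e y))) hθp e4).trans
      ((congrArg (piSBReindex F e).symm
          (pairRep_finPairToAdelic_piSBReindex_tmul F E c N M e JV JW hcδ hδ hd hV hW hVd hWd hJV hJW hs (φ k', u) φ₀ (Qf g))).trans
        ((piSBReindex F e).symm_apply_apply _))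
  have cmp := eL.symm.trans (key.trans eR)
  -- strip the archimedean factor with the finite slice at the origin
  have s1 := finSliceLM_tmul (0 : (Fin N × Fin M) → mixedSpace F) φ₀
    (Qf (finPairRep F E c N M e JV' JW hcδ hδ hd hV' hW hVd' hWd hJV' hJW hs' (k', u) g))
  have s2 := finSliceLM_tmul (0 : (Fin N × Fin M) → mixedSpace F) φ₀
    (finPairRep F E c N M e JV JW hcδ hδ hd hV hW hVd hWd hJV hJW hs (φ k', u) (Qf g))
  rw [hφ₀, one_smul] at s1 s2
  have fin : Qf (finPairRep F E c N M e JV' JW hcδ hδ hd hV' hW hVd' hWd hJV' hJW hs' (k', u) g) =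
      finPairRep F E c N M e JV JW hcδ hδ hd hV hW hVd hWd hJV hJW hs (φ k', u) (Qf g) :=
    s1.symm.trans ((congrArg (finSliceLM F (Fin N × Fin M) 0) cmp).trans s2)
  rw [LinearEquiv.conj_apply, LinearEquiv.symm_symm, LinearMap.comp_apply, LinearMap.comp_apply, LinearEquiv.coe_coe,
    LinearEquiv.coe_coe, ← fin, LinearEquiv.symm_apply_apply]

end Head

end Literature.NumberTheory.GelbartRogawski1991.UnitaryDualPair.WeilCoinv

end
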